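import Summits.CriticalPhenomena.SAWScalingLimit.Theorems.SAWDevelopingMapHexTightOnFrontierPerShellTight
import HarnessLib

/-!
# Net localization with frontier control only NEAR the middle circle (stmt-CriticalPhenomena-5423)

Crux `Summit.CriticalPhenomena.SAWScalingLimit.Theses.SAWResidueField.HexTight` (shared verbatim with
`…Theses.SAWDevelopingMap.HexTight`), line `reversal-virgin-disc`, skeleton r9, stub `stub_netNear`.

This is the master localization lemma `perShellTight_thin_of_net` (file
`SAWDevelopingMapHexTightOnFrontierPerShellTight`) with ONE change: its frontier hypothesis is asked only of the
frontier points `x''` in the closed `10w`-neighbourhood of the middle circle of the shell `D(x; ρ, R)`, i.e. with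
`m - 10w ≤ dist x'' x ≤ m + 10w` (`m = (ρ+R)/2`, `w = 2πm/M`). The proof is the same union bound over the `M` net
shells `D(c_j; w, hh - w)` (`hh = (R-ρ)/2`, `c_j = x + m e^{i(-π + 2πj/M)}`) of
`Curve.exists_net_hasTraversals_of_hasTraversals`: a net shell is interior (`closedBall c_j (8w) ⊆ Ω`, the interior
atom at tolerance `η₁/M`), or has its inner ball off `closure Ω` (empty event, `not_hasTraversals_one_of_disjoint`), or
sits within `10w` of a frontier point `x''` (`exists_frontier_near`); since `dist c_j x = m`, such an `x''` lies in
the `10w`-neighbourhood of the middle circle, which is exactly where the frontier hypothesis is available.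

References: M. Aizenman, A. Burchard, Duke Math. J. 99 (1999) §1.b, §3.a [AizenmanBurchardDuke1999];
H. Duminil-Copin, S. Smirnov, Ann. of Math. 175 (2012) §4 [DuminilCopinSmirnov2012].
-/

noncomputable section

open scoped BigOperators Classical ENNReal
open MeasureTheory Filter Topology Set Metric
open Literature.Probability.LatticeModels Literature.Probability.RandomPlanarGeometry
  Literature.Probability.RandomPlanarGeometry.SAW

namespace Summit.CriticalPhenomena.SAWScalingLimit.Theorems.HexTight.BoundaryOnFrontier

open Summit.CriticalPhenomena.SAWScalingLimit.Theorems.HexTight.ExponentBootstrap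

/-- **Master net localization with frontier control only near the middle circle.** Let `Ω` be open with
thin-interior per-shell tightness of the traversal number (`0 < ρ'`, `4ρ' < R' ≤ 1`, `closedBall x' R' ⊆ Ω`). Fix a
thin shell `D(x; ρ, R)` (`0 < ρ`, `4ρ < R ≤ 1`), write `m = (ρ+R)/2`, `hh = (R-ρ)/2`, and take a net size `M` with
`176π m / hh < M` (net mesh `w = 2πm/M`, `88 w < hh`). If every shell `D(x''; 11w, hh/2)` centred at a frontier point
`x''` with `m - 10w ≤ dist x'' x ≤ m + 10w` has a threshold whose traversal probability is `≤ β` at small meshes, then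
for every `η₁ > 0` the shell `D(x; ρ, R)` has a threshold whose traversal probability is `≤ η₁ + M β` at small meshes.
(Each of the `M` net shells `D(c_j; w, hh - w)` of `Curve.exists_net_hasTraversals_of_hasTraversals` is interior —
`closedBall c_j (8w) ⊆ Ω`, charge `η₁/M` by the interior atom on `D(c_j; w, 8w)` —, or has `closedBall c_j w` off
`closure Ω` — empty event —, or lies within `10w` of a frontier point `x''` (`exists_frontier_near`), which is then
within `10w` of the middle circle because `dist c_j x = m` — charge `β` on `D(x''; 11w, hh/2)`; union bound.) -/
theorem stub_netNear :
    ∀ (Ω : Set ℂ), IsOpen Ω → ∀ (a b : ℝ → HexVertex),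
      (∀ (x : ℂ) (ρ R : ℝ), 0 < ρ → 4 * ρ < R → R ≤ 1 → Metric.closedBall x R ⊆ Ω → ∀ η : ℝ, 0 < η →
        ∃ (k : ℕ) (δ₁ : ℝ), 0 < δ₁ ∧ ∀ δ ∈ Set.Ioc (0 : ℝ) δ₁, δ ≤ ρ →
          hexSAWLaw Ω δ (a δ) (b δ)
            {γ | (⟨γ.walk.toCurve fun v => (δ : ℂ) * hexCenter v⟩ : Curve ℂ).HasTraversals k x ρ R} ≤
            ENNReal.ofReal η) →
      ∀ (x : ℂ) (ρ R : ℝ), 0 < ρ → 4 * ρ < R → R ≤ 1 →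
        ∀ (M : ℕ), 176 * Real.pi * ((ρ + R) / 2) / ((R - ρ) / 2) < M → ∀ (β η₁ : ℝ), 0 ≤ β → 0 < η₁ →
        (∀ x'' ∈ frontier Ω,
          (ρ + R) / 2 - 10 * (2 * Real.pi * ((ρ + R) / 2) / M) ≤ dist x'' x →
          dist x'' x ≤ (ρ + R) / 2 + 10 * (2 * Real.pi * ((ρ + R) / 2) / M) →
          ∃ (k : ℕ) (δ₁ : ℝ), 0 < δ₁ ∧ ∀ δ ∈ Set.Ioc (0 : ℝ) δ₁,
            δ ≤ 11 * (2 * Real.pi * ((ρ + R) / 2) / M) →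
            hexSAWLaw Ω δ (a δ) (b δ)
              {γ | (⟨γ.walk.toCurve fun v => (δ : ℂ) * hexCenter v⟩ : Curve ℂ).HasTraversals k x''
                (11 * (2 * Real.pi * ((ρ + R) / 2) / M)) ((R - ρ) / 4)} ≤ ENNReal.ofReal β) →
        ∃ (k : ℕ) (δ₁ : ℝ), 0 < δ₁ ∧ ∀ δ ∈ Set.Ioc (0 : ℝ) δ₁,
          hexSAWLaw Ω δ (a δ) (b δ)
            {γ | (⟨γ.walk.toCurve fun v => (δ : ℂ) * hexCenter v⟩ : Curve ℂ).HasTraversals k x ρ R} ≤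
            ENNReal.ofReal (η₁ + M * β) := by
  intro Ω hΩ a b hI x ρ R hρ h4 hR1 M hM β η₁ hβ hη₁ hF
  have hρR : ρ < R := by linarith
  -- middle radius `m`, half width `hh`, net mesh `w`
  set m : ℝ := (ρ + R) / 2 with hm
  set hh : ℝ := (R - ρ) / 2 with hhh
  set w : ℝ := 2 * Real.pi * m / M with hw
  have hmpos : 0 < m := by rw [hm]; linarith
  have hhpos : 0 < hh := by rw [hhh]; linarith
  have hh1 : hh ≤ 1 / 2 := by rw [hhh]; linarith
  have hquot : 0 ≤ 176 * Real.pi * m / hh := by positivity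
  have hMpos : (0 : ℝ) < M := hquot.trans_lt hM
  have hM0 : M ≠ 0 := by rintro rfl; simp at hMpos
  have hM1 : 1 ≤ M := Nat.one_le_iff_ne_zero.2 hM0
  have hMne : (M : ℝ) ≠ 0 := hMpos.ne'
  have hwpos : 0 < w := by rw [hw]; positivity
  have h88 : 88 * w < hh := by
    have h1 : 176 * Real.pi * m < M * hh := by
      have := (div_lt_iff₀ hhpos).1 hM; linarith [mul_comm (M : ℝ) hh]
    rw [hw, show 88 * (2 * Real.pi * m / M) = 176 * Real.pi * m / M by ring, div_lt_iff₀ hMpos]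
    linarith [mul_comm (M : ℝ) hh]
  have hquarter : (R - ρ) / 4 = hh / 2 := by rw [hhh]; ring
  -- net centres
  set c : ℕ → ℂ := fun j : ℕ => x + ((m : ℝ) : ℂ) *
      Complex.exp (((-Real.pi + 2 * Real.pi * (j : ℝ) / M : ℝ) : ℂ) * Complex.I) with hc
  -- the net centres lie ON the middle circle
  have hcdist : ∀ j : ℕ, dist (c j) x = m := fun j => by
    simp only [hc, dist_eq_norm, add_sub_cancel_left, norm_mul, Complex.norm_real, Real.norm_eq_abs,
      Complex.norm_exp_ofReal_mul_I, mul_one, abs_of_pos hmpos]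
  -- the charge of one net point
  have key : ∀ j : ℕ, ∃ (kj : ℕ) (δj : ℝ), 0 < δj ∧ ∀ δ ∈ Set.Ioc (0 : ℝ) δj,
      hexSAWLaw Ω δ (a δ) (b δ)
        {γ | (⟨γ.walk.toCurve fun v => (δ : ℂ) * hexCenter v⟩ : Curve ℂ).HasTraversals kj (c j) w (hh - w)} ≤
        ENNReal.ofReal (η₁ / M) + ENNReal.ofReal β := by
    intro j
    by_cases hA : Metric.closedBall (c j) (8 * w) ⊆ Ω
    · -- interior net shell `D(c j; w, 8w)`
      obtain ⟨k, δ₁, hδ₁, hk⟩ :=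
        hI (c j) w (8 * w) hwpos (by linarith) (by linarith) hA (η₁ / M) (by positivity)
      refine ⟨k, min δ₁ w, lt_min hδ₁ hwpos, fun δ hδ => ?_⟩
      have hδ' : δ ∈ Set.Ioc (0 : ℝ) δ₁ := ⟨hδ.1, hδ.2.trans (min_le_left _ _)⟩
      have hδw : δ ≤ w := hδ.2.trans (min_le_right _ _)
      calc hexSAWLaw Ω δ (a δ) (b δ) _
          ≤ hexSAWLaw Ω δ (a δ) (b δ)
              {γ | (⟨γ.walk.toCurve fun v => (δ : ℂ) * hexCenter v⟩ : Curve ℂ).HasTraversals k (c j) w (8 * w)} :=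
            measure_mono fun γ hγ => Curve.HasTraversals.mono' hγ le_rfl (by linarith)
        _ ≤ ENNReal.ofReal (η₁ / M) := hk δ hδ' hδw
        _ ≤ ENNReal.ofReal (η₁ / M) + ENNReal.ofReal β := le_self_add
    · by_cases hB : Disjoint (Metric.closedBall (c j) w) (closure Ω)
      · -- inner ball off `closure Ω`: empty event at threshold `1`
        refine ⟨1, 1, one_pos, fun δ _ => ?_⟩
        have hempty : {γ : HexDomainSAW Ω δ (a δ) (b δ) |
            (⟨γ.walk.toCurve fun v => (δ : ℂ) * hexCenter v⟩ : Curve ℂ).HasTraversals 1 (c j) w (hh - w)} = ∅ :=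
          Set.eq_empty_of_forall_notMem fun γ hγ =>
            not_hasTraversals_one_of_disjoint hB (by linarith) γ hγ
        rw [hempty, measure_empty]
        exact bot_le
      · -- a frontier point `x''` within `10w` of `c j`, hence within `10w` of the middle circle
        obtain ⟨z, hzball, hzΩ⟩ := Set.not_subset.1 hA
        obtain ⟨y, hyball, hycl⟩ := Set.not_disjoint_iff.1 hB
        rw [Metric.mem_closedBall] at hyball hzball
        rw [dist_comm] at hzball
        obtain ⟨x'', hx''fr, hx''d⟩ := exists_frontier_near hΩ hycl hyball hzΩ hzball
        have hlo : m - 10 * w ≤ dist x'' x := by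
          have h1 := dist_triangle (c j) x'' x
          rw [hcdist j] at h1
          linarith
        have hhi : dist x'' x ≤ m + 10 * w := by
          have h1 := dist_triangle x'' (c j) x
          rw [hcdist j, dist_comm x'' (c j)] at h1
          linarith
        obtain ⟨k, δ₁, hδ₁, hk⟩ := hF x'' hx''fr hlo hhi
        refine ⟨k, min δ₁ w, lt_min hδ₁ hwpos, fun δ hδ => ?_⟩
        have hδ' : δ ∈ Set.Ioc (0 : ℝ) δ₁ := ⟨hδ.1, hδ.2.trans (min_le_left _ _)⟩
        have hδw : δ ≤ 11 * w := (hδ.2.trans (min_le_right _ _)).trans (by linarith)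
        calc hexSAWLaw Ω δ (a δ) (b δ) _
            ≤ hexSAWLaw Ω δ (a δ) (b δ)
                {γ | (⟨γ.walk.toCurve fun v => (δ : ℂ) * hexCenter v⟩ : Curve ℂ).HasTraversals k x''
                  (11 * w) ((R - ρ) / 4)} := by
              refine measure_mono fun γ hγ => ?_
              have h1 : (⟨γ.walk.toCurve fun v => (δ : ℂ) * hexCenter v⟩ : Curve ℂ).HasTraversals k x''
                  (11 * w) (hh - 11 * w) :=
                Curve.HasTraversals.mono hγ (by linarith) (by linarith)
              rw [Set.mem_setOf_eq, hquarter]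
              exact h1.mono' le_rfl (by linarith)
          _ ≤ ENNReal.ofReal β := hk δ hδ' hδw
          _ ≤ ENNReal.ofReal (η₁ / M) + ENNReal.ofReal β := le_add_self
  choose kj δj hδj hkj using key
  -- a common mesh bound for the `M` net points
  obtain ⟨j₀, hj₀, hmin⟩ := (Finset.range M).exists_min_image δj ⟨0, Finset.mem_range.2 hM1⟩
  refine ⟨∑ j ∈ Finset.range M, kj j, min w (δj j₀), lt_min hwpos (hδj j₀), fun δ hδ => ?_⟩
  have hsub : {γ : HexDomainSAW Ω δ (a δ) (b δ) |
      (⟨γ.walk.toCurve fun v => (δ : ℂ) * hexCenter v⟩ : Curve ℂ).HasTraversals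
        (∑ j ∈ Finset.range M, kj j) x ρ R} ⊆
      ⋃ j ∈ Finset.range M, {γ | (⟨γ.walk.toCurve fun v => (δ : ℂ) * hexCenter v⟩ : Curve ℂ).HasTraversals
        (kj j) (c j) w (hh - w)} := by
    intro γ hγ
    obtain ⟨j, hj, hjT⟩ := Curve.exists_net_hasTraversals_of_hasTraversals hρ.le hρR hM1 (fun j => kj j) hγ
    refine Set.mem_iUnion₂.2 ⟨j, Finset.mem_range.2 hj, ?_⟩
    simpa only [hc, hw, hm, hhh, Set.mem_setOf_eq] using hjT
  have hper : ∀ j ∈ Finset.range M,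
      hexSAWLaw Ω δ (a δ) (b δ) {γ | (⟨γ.walk.toCurve fun v => (δ : ℂ) * hexCenter v⟩ : Curve ℂ).HasTraversals
        (kj j) (c j) w (hh - w)} ≤ ENNReal.ofReal (η₁ / M) + ENNReal.ofReal β := fun j hj =>
    hkj j δ ⟨hδ.1, (hδ.2.trans (min_le_right _ _)).trans (hmin j hj)⟩
  have htot : (M : ℝ≥0∞) * (ENNReal.ofReal (η₁ / M) + ENNReal.ofReal β) = ENNReal.ofReal (η₁ + M * β) := by
    rw [mul_add, ← ENNReal.ofReal_natCast M, ← ENNReal.ofReal_mul (Nat.cast_nonneg M),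
      ← ENNReal.ofReal_mul (Nat.cast_nonneg M), mul_div_cancel₀ _ hMne,
      ← ENNReal.ofReal_add hη₁.le (by positivity)]
  calc hexSAWLaw Ω δ (a δ) (b δ) _
      ≤ hexSAWLaw Ω δ (a δ) (b δ) (⋃ j ∈ Finset.range M, {γ |
          (⟨γ.walk.toCurve fun v => (δ : ℂ) * hexCenter v⟩ : Curve ℂ).HasTraversals
            (kj j) (c j) w (hh - w)}) := measure_mono hsub
    _ ≤ ∑ j ∈ Finset.range M, hexSAWLaw Ω δ (a δ) (b δ) {γ |
          (⟨γ.walk.toCurve fun v => (δ : ℂ) * hexCenter v⟩ : Curve ℂ).HasTraversals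
            (kj j) (c j) w (hh - w)} := measure_biUnion_finset_le _ _
    _ ≤ ∑ j ∈ Finset.range M, (ENNReal.ofReal (η₁ / M) + ENNReal.ofReal β) := Finset.sum_le_sum hper
    _ = (M : ℝ≥0∞) * (ENNReal.ofReal (η₁ / M) + ENNReal.ofReal β) := by
        rw [Finset.sum_const, Finset.card_range, nsmul_eq_mul]
    _ = ENNReal.ofReal (η₁ + M * β) := htot

end Summit.CriticalPhenomena.SAWScalingLimit.Theorems.HexTight.BoundaryOnFrontier

end
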